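import Mathlib.Topology.Algebra.Category.ProfiniteGrp.Completion
import Mathlib.Data.ZMod.QuotientGroup
import Literature.IUT.HodgeTheaters.CompactAbelianProLPart
import Literature.IUT.HodgeTheaters.TemperedCoveringsProofs
import Literature.IUT.HodgeTheaters.DiscreteProfiniteCompletionsProofs
import Literature.AnabelianGeometry.SemiGraphs.TemperedAnabelian
import HarnessLib

/-!
# [IUTchI] Cor. 2.5, inertia part: "the unique maximal pro-`Σ` subgroup of `I_x ≅ Ẑ(1)`" — the atom BY NAME, PROOFS

Mochizuki, *Inter-universal Teichmüller theory I*, kurims manuscript (May 2020), §2, proof of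
Cor. 2.5, p. 51 [cite: Mochizuki2012, Cor 2.5 p.51] (D-0012 claim key; series status DISPUTED —
nothing on this page is contested): "when `x` is a cusp of `X` [so `I_x ≅ Ẑ(1)`], it follows —
i.e., by applying Proposition 2.4, (i), to the unique maximal pro-`Σ` subgroup of `I_x` — that …".
PROOF-ONLY sequel of `CompactAbelianProLPart` (abc-iut-L5-t11; no definitions, nothing printed is
asserted): (1) `Ẑ` — Mathlib's `ProfiniteGrp.ProfiniteCompletion.completion` of `ℤ`, which IS the
tree's `Literature.AnabelianGeometry.SemiGraphs.ZHat` of the [SemiAnbd] §6 interface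
(`TemperedCurve.inertia_equiv_zHat : "I_x … is isomorphic to Ẑ(1)"`, abc-iut-L3-t2) — (= abc-iut-L5-t1's
`Literature.IUT.HodgeTheaters.ZHat`, `zHat_eq_semiGraphs_zHat`) has commuting elements
(`ZHat.mul_comm`, `DiscreteProfiniteCompletionsProofs`) and discrete quotients `ℤ/l^(n+1)` with an
element of order `l^(n+1)` (`zHat_exists_pow_mem_and_not_mem`); hence (2) every finite-index subgroup of `Ẑ`, and of any
topological group `I ≃ₜ* Ẑ`, contains a nontrivial compact pro-`Σ` subgroup whenever `Σ` contains a
prime (`zHat_exists_compact_proSigma_le`, `exists_compact_proSigma_le_of_mulEquiv_zHat`); and (3) the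
hypothesis `hI` of `StableCurveTemperedData.cor25Inertia_of_prop24i` is DISCHARGED for any
[IUTchI] §2 datum whose cusp inertia groups are identified with `Ẑ`
(`StableCurveTemperedData.proSigmaAtom_le_of_finiteIndex_of_equiv_zHat` — finite-index subgroups of
`I_x` —, `….proSigmaInertiaAtom_of_equiv_zHat`, `….cor25Inertia_of_prop24i_of_equiv_zHat`):
Cor. 2.5 (inertia) now follows from Prop. 2.4 (i) and "`I_x ≅ Ẑ(1)`" BY NAME.
-/

namespace Literature.IUT.HodgeTheaters

open Topology
open Literature.AnabelianGeometry.SemiGraphs (IsProSigma)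

universe u

/-! ### Transport of the atom along topological isomorphisms -/

section Transport

variable {I : Type*} [Group I] [TopologicalSpace I] {Z : Type*} [Group Z] [TopologicalSpace Z]

/-- The property "every finite-index subgroup contains a nontrivial compact pro-`Σ` subgroup"
transports along isomorphisms of topological groups. [cite: Mochizuki2012, Cor 2.5 p.51] -/
theorem exists_compact_proSigma_le_of_continuousMulEquiv (e : I ≃ₜ* Z) {S : Set ℕ}
    (hZ : ∀ J : Subgroup Z, J.FiniteIndex →
      ∃ Λ : Subgroup Z, Λ ≤ J ∧ IsCompact (Λ : Set Z) ∧ Λ ≠ ⊥ ∧ IsProSigma S Λ)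
    (J : Subgroup I) [hJ : J.FiniteIndex] :
    ∃ Λ : Subgroup I, Λ ≤ J ∧ IsCompact (Λ : Set I) ∧ Λ ≠ ⊥ ∧ IsProSigma S Λ := by
  have hJ' : (J.comap e.symm.toMonoidHom).FiniteIndex :=
    ⟨by rw [Subgroup.index_comap_of_surjective _ e.symm.surjective]; exact hJ.index_ne_zero⟩
  obtain ⟨Λ', hle, hc, hne, hS⟩ := hZ (J.comap e.symm.toMonoidHom) hJ'
  -- membership in the pulled-back subgroups, definitionally
  have hmemΛ : ∀ x : I, x ∈ Λ'.comap e.toMonoidHom ↔ e x ∈ Λ' := fun x => Iff.rfl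
  have hmemJ : ∀ y : Z, y ∈ J.comap e.symm.toMonoidHom ↔ e.symm y ∈ J := fun y => Iff.rfl
  refine ⟨Λ'.comap e.toMonoidHom, fun x hx => ?_, ?_, ?_, ?_⟩
  · have h := (hmemJ _).mp (hle ((hmemΛ x).mp hx))
    rwa [ContinuousMulEquiv.symm_apply_apply] at h
  · have hset : (Λ'.comap e.toMonoidHom : Set I) = e.symm '' (Λ' : Set Z) := by
      ext x
      rw [SetLike.mem_coe, hmemΛ, Set.mem_image]
      constructor
      · intro hx
        exact ⟨e x, hx, e.symm_apply_apply x⟩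
      · rintro ⟨y, hy, rfl⟩
        rwa [ContinuousMulEquiv.apply_symm_apply]
    rw [hset]
    exact hc.image e.symm.continuous
  · intro hbot
    apply hne
    rw [Subgroup.eq_bot_iff_forall] at hbot ⊢
    intro y hy
    have h1 : e.symm y = 1 := hbot (e.symm y) (by
      rw [hmemΛ, ContinuousMulEquiv.apply_symm_apply]
      exact hy)
    have h2 : e (e.symm y) = e 1 := congrArg e h1
    rwa [ContinuousMulEquiv.apply_symm_apply, map_one] at h2
  · -- `Λ' ↠ Λ'.comap e` by the restriction of `e.symm`
    have hcod : ∀ y : Λ', (e.symm.toMonoidHom.comp Λ'.subtype) y ∈ Λ'.comap e.toMonoidHom := by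
      intro y
      rw [hmemΛ]
      change e (e.symm (y : Z)) ∈ Λ'
      rw [ContinuousMulEquiv.apply_symm_apply]
      exact y.2
    refine isProSigma_of_surjective hS
      ((e.symm.toMonoidHom.comp Λ'.subtype).codRestrict (Λ'.comap e.toMonoidHom) hcod) ?_ ?_
    · refine continuous_induced_rng.2 ?_
      exact e.symm.continuous.comp continuous_subtype_val
    · rintro ⟨x, hx⟩
      refine ⟨⟨e x, (hmemΛ x).mp hx⟩, Subtype.ext ?_⟩
      change e.symm (e x) = x
      exact e.symm_apply_apply x

end Transport

/-! ### `Ẑ`: the quotients `ℤ/l^(n+1)` -/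

section ZHat

/-- The two names of `Ẑ` in the tree agree: [IUTchI] §2's `Literature.IUT.HodgeTheaters.ZHat`
(Lemma 2.7 (v), p. 57; abc-iut-L5-t1) is the underlying type of [SemiAnbd] §6's
`Literature.AnabelianGeometry.SemiGraphs.ZHat` (p. 71, "`I_x` is isomorphic to `Ẑ(1)`";
abc-iut-L3-t2) — both are Mathlib's profinite completion of `ℤ`; so the theorems below apply
verbatim to `TemperedCurve.inertia_equiv_zHat`. [cite: MochizukiSemiAnbd2006, §6 p.71] -/
theorem zHat_eq_semiGraphs_zHat : ZHat = ↥Literature.AnabelianGeometry.SemiGraphs.ZHat := rfl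

/-- For a prime `l` and every `n`, `Ẑ` has an open normal subgroup `W` (the kernel of
`Ẑ ↠ ℤ/l^(n+1)`) and an element `z` (the image of `1 ∈ ℤ`) with `z ^ (l ^ (n+1)) ∈ W`,
`z ^ (l ^ n) ∉ W`. [cite: MochizukiSemiAnbd2006, §6 p.71] -/
theorem zHat_exists_pow_mem_and_not_mem {l : ℕ} (hl : l.Prime) (n : ℕ) :
    ∃ (W : OpenNormalSubgroup ZHat) (z : ZHat),
      z ^ l ^ (n + 1) ∈ W.toSubgroup ∧ z ^ l ^ n ∉ W.toSubgroup := by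
  -- the finite-index subgroup `l^(n+1) ℤ ⊆ ℤ`
  let H : FiniteIndexNormalSubgroup (GrpCat.of (Multiplicative ℤ)) :=
    { toSubgroup := AddSubgroup.toSubgroup (A := ℤ) (AddSubgroup.zmultiples ((l : ℤ) ^ (n + 1)))
      isFiniteIndex' := ⟨by
        rw [AddSubgroup.index_toSubgroup, Int.index_zmultiples]
        exact Int.natAbs_ne_zero.mpr (pow_ne_zero _ (Int.natCast_ne_zero.mpr hl.ne_zero))⟩ }
  haveI : H.toSubgroup.FiniteIndex := H.isFiniteIndex'
  -- the projection `Ẑ → ℤ / l^(n+1) ℤ`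
  let f : ZHat →* (ProfiniteGrp.ProfiniteCompletion.diagram (GrpCat.of (Multiplicative ℤ))).obj H :=
    MonoidHom.mk' (fun x => x.val H) fun x y => ProfiniteGrp.limit_mul_val _ x y H
  have hf : Continuous f := (continuous_apply H).comp continuous_subtype_val
  haveI : Finite ((ProfiniteGrp.ProfiniteCompletion.diagram (GrpCat.of (Multiplicative ℤ))).obj H) :=
    (inferInstance : Finite (Multiplicative ℤ ⧸ H.toSubgroup))
  have hclosed : IsClosed (f.ker : Set ZHat) := by
    have e : (f.ker : Set ZHat) = f ⁻¹' {1} := by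
      ext x
      exact Iff.rfl
    rw [e]
    exact isClosed_singleton.preimage hf
  have hopen : IsOpen (f.ker : Set ZHat) := Subgroup.isOpen_of_isClosed_of_finiteIndex _ hclosed
  -- membership of powers of `z = η(1)` in the kernel
  have hmem : ∀ k : ℕ,
      ProfiniteGrp.ProfiniteCompletion.etaFn (GrpCat.of (Multiplicative ℤ))
        (Multiplicative.ofAdd (1 : ℤ)) ^ k ∈ f.ker ↔ l ^ (n + 1) ∣ k := by
    intro k
    rw [MonoidHom.mem_ker, map_pow]
    change (QuotientGroup.mk (Multiplicative.ofAdd (1 : ℤ)) : Multiplicative ℤ ⧸ H.toSubgroup) ^ k = 1 ↔ _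
    rw [← QuotientGroup.mk_pow, QuotientGroup.eq_one_iff]
    change Multiplicative.ofAdd (1 : ℤ) ^ k ∈
      AddSubgroup.toSubgroup (A := ℤ) (AddSubgroup.zmultiples ((l : ℤ) ^ (n + 1))) ↔ _
    rw [Multiplicative.mem_toSubgroup, toAdd_pow, toAdd_ofAdd, nsmul_eq_mul, mul_one,
      Int.mem_zmultiples_iff]
    exact_mod_cast Int.natCast_dvd_natCast
  refine ⟨⟨⟨f.ker, hopen⟩, inferInstance⟩,
    ProfiniteGrp.ProfiniteCompletion.etaFn (GrpCat.of (Multiplicative ℤ)) (Multiplicative.ofAdd (1 : ℤ)),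
    (hmem _).mpr dvd_rfl, fun h => ?_⟩
  have h' := (hmem _).mp h
  exact absurd (Nat.le_of_dvd (pow_pos hl.pos n) h')
    (not_le.mpr (Nat.pow_lt_pow_right hl.one_lt n.lt_succ_self))

/-- **Every finite-index subgroup of `Ẑ` contains a nontrivial compact pro-`Σ` subgroup**, for any
set `Σ` containing a prime `l` (a nontrivial compact subgroup of the pro-`l` part `ℤ_l ⊆ Ẑ`).
[cite: Mochizuki2012, Cor 2.5 p.51] -/
theorem zHat_exists_compact_proSigma_le {S : Set ℕ} {l : ℕ} (hl : l.Prime) (hlS : l ∈ S)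
    (J : Subgroup ZHat) [J.FiniteIndex] :
    ∃ Λ : Subgroup ZHat, Λ ≤ J ∧ IsCompact (Λ : Set ZHat) ∧ Λ ≠ ⊥ ∧ IsProSigma S Λ :=
  exists_compact_proSigma_le_of_finiteIndex hl hlS ZHat.mul_comm
    (zHat_exists_pow_mem_and_not_mem hl) J

/-- The same for any topological group `I` identified with `Ẑ` (e.g. a cusp inertia group,
"`I_x ≅ Ẑ(1)`"). [cite: Mochizuki2012, Cor 2.5 p.51] -/
theorem exists_compact_proSigma_le_of_mulEquiv_zHat {I : Type*} [Group I] [TopologicalSpace I]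
    [IsTopologicalGroup I] (e : I ≃ₜ* ZHat) {S : Set ℕ} {l : ℕ} (hl : l.Prime) (hlS : l ∈ S)
    (J : Subgroup I) [J.FiniteIndex] :
    ∃ Λ : Subgroup I, Λ ≤ J ∧ IsCompact (Λ : Set I) ∧ Λ ≠ ⊥ ∧ IsProSigma S Λ :=
  exists_compact_proSigma_le_of_continuousMulEquiv e
    (fun J' _ => zHat_exists_compact_proSigma_le hl hlS J') J

end ZHat

/-! ### Cor. 2.5 (inertia part) from Prop. 2.4 (i) and `I_x ≅ Ẑ(1)` BY NAME -/

namespace StableCurveTemperedData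

variable (D : StableCurveTemperedData.{u})

/-- **Pro-`Σ` parts of finite-index subgroups of `I_x ≅ Ẑ(1)`**: if the cusp inertia group
`I_x ⊆ Δ^tp_X` is identified, as a topological group, with `Ẑ`, then every finite-index subgroup
`J ⊆ I_x` contains a nontrivial compact pro-`Σ` subgroup of `Δ^tp_X` (`Σ` the datum's nonempty set
of primes) — the finite-index form of the atom (used downstream at the level of the open subgroups
`J ∩ I_x` of the proof of Cor. 2.5 / [IUTchII] §2). [cite: Mochizuki2012, Cor 2.5 p.51] -/
theorem proSigmaAtom_le_of_finiteIndex_of_equiv_zHat {x : D.Cusp} (e : ↥(D.inertiaTp x) ≃ₜ* ZHat)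
    (J : Subgroup ↥(D.inertiaTp x)) [J.FiniteIndex] :
    ∃ P : Subgroup D.DeltaTp, P ≤ J.map (D.inertiaTp x).subtype ∧
      IsCompact (P : Set D.DeltaTp) ∧ P ≠ ⊥ ∧ IsProSigma D.graph.Sigma P := by
  obtain ⟨l, hl⟩ := D.graph.sigma_nonempty
  have hlp : l.Prime := D.graph.sigmaHat_prime l (D.graph.sigma_subset hl)
  obtain ⟨Λ, hΛJ, hc, hne, hS⟩ := exists_compact_proSigma_le_of_mulEquiv_zHat e hlp hl J
  refine ⟨Λ.map (D.inertiaTp x).subtype, Subgroup.map_mono hΛJ, ?_, ?_, ?_⟩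
  · rw [Subgroup.coe_map]
    exact hc.image continuous_subtype_val
  · rwa [Ne, Subgroup.map_eq_bot_iff_of_injective _ (Subgroup.subtype_injective _)]
  · refine isProSigma_of_surjective hS
      (Subgroup.equivMapOfInjective Λ (D.inertiaTp x).subtype
        (Subgroup.subtype_injective _)).toMonoidHom ?_
      (Subgroup.equivMapOfInjective Λ _ _).surjective
    refine continuous_induced_rng.2 ?_
    exact (continuous_subtype_val.comp continuous_subtype_val).congr fun _ => rfl

/-- **The atom "the unique maximal pro-`Σ` subgroup of `I_x`"**, discharged: if each cusp inertia
group `I_x ⊆ Δ^tp_X` of the datum is identified, as a topological group, with `Ẑ` ("`I_x ≅ Ẑ(1)`",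
p. 51; [SemiAnbd] §6 p. 71), then each `I_x` contains a nontrivial compact pro-`Σ` subgroup (`Σ` the
datum's nonempty set of primes) — the hypothesis `hI` of `cor25Inertia_of_prop24i`.
[cite: Mochizuki2012, Cor 2.5 p.51] -/
theorem proSigmaInertiaAtom_of_equiv_zHat (e : ∀ x : D.Cusp, ↥(D.inertiaTp x) ≃ₜ* ZHat) :
    ∀ x : D.Cusp, ∃ P : Subgroup D.DeltaTp, P ≤ D.inertiaTp x ∧
      IsCompact (P : Set D.DeltaTp) ∧ P ≠ ⊥ ∧ IsProSigma D.graph.Sigma P := by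
  intro x
  obtain ⟨P, hle, hc, hne, hS⟩ := D.proSigmaAtom_le_of_finiteIndex_of_equiv_zHat (e x) ⊤
  exact ⟨P, hle.trans (Subgroup.map_subtype_le _), hc, hne, hS⟩

/-- **Cor. 2.5 (inertia groups of cusps) from Prop. 2.4 (i) and "`I_x ≅ Ẑ(1)`"**: the printed
proof (p. 51) BY NAME — Prop. 2.4 (i) for the datum (`h`), the identification of each cusp inertia
group with `Ẑ` (`e`), and "`X` has a cusp".  [`cor25Inertia_of_prop24i` with its atom `hI`
discharged by `proSigmaInertiaAtom_of_equiv_zHat`.] [cite: Mochizuki2012, Cor 2.5 p.51] -/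
theorem cor25Inertia_of_prop24i_of_equiv_zHat (h : D.Prop24i) [Nonempty D.Cusp]
    (e : ∀ x : D.Cusp, ↥(D.inertiaTp x) ≃ₜ* ZHat) : D.Cor25Inertia :=
  D.cor25Inertia_of_prop24i h (D.proSigmaInertiaAtom_of_equiv_zHat e)

end StableCurveTemperedData

end Literature.IUT.HodgeTheaters
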